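/-
Copyright: the b2b-balaban T⁴-continuum CRUX team, row NE7b OWNER lineage `t4-ne7b-p1` (gen 146). Project licence.
-/
import Summits.QuantumFields.BalabanUV.T4Continuum.Spine.NE7b.SupWeightedTwoPointMastersTwo
import Summits.QuantumFields.BalabanUV.T4Continuum.Spine.NE7b.SupWeightedFivePointToolsThree
import Summits.QuantumFields.BalabanUV.T4Continuum.Spine.NE7b.SupFivePointGreedyRowSum

/-!
# THE WEIGHTED FIFTH-ORDER SLOT LETTER, SLOT FIVE (`s` fixed), PART 6 OF 8 (SCOPING-d17 §F, F13–F17; file (734)).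
# The interpolated entry majorant `M₅′` of (687) (52 terms, no support indicator, product decay) summed over its four free indices against
# the full-graph weight `W = Π_{10 pairs}ϑ` with `s` fixed — the OUTPUT slot letter of the weighted class at order five — from weighted INPUT
# letters only: the full-graph `ϑ₂`-weighted `K5` letter of this role, the `σ`-profile letters of the `Hk`∕`K3`∕`K4`∕`K5` families (masses and
# columns; discharged from intrinsic letters as in (659)∕(666)), the `ϑ₂`-weighted `Hk`∕`K3` letters, and three geometry letters (`G = sup
# Σϑ⁶∕√ρ`, `Θ8 = sup Σϑ⁸∕ϑ₂`, `S2 = sup Σϑ²∕r₁`).  ROUTING: every pair of the five indices is carried along the term's tree (loads `≤ 6` on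
# `ρ`-edges and the crossing edge — `ϑ⁶ ≤ σσ` —, `≤ 4` on Hessian∕internal edges — `ϑ⁴ ≤ ϑ₂` —, `≤ 2` on `r₁`-star edges; non-star pairs of the
# product-decay terms absorbed by `ϑ ≤ r₁`), then summed leaf-first ((689)∕(691)).  NO support letter, NO finite-range hypothesis
# (row NE7b, node U5c; (653), (656), (687), (689), (691) BY NAME; [folklore]).

Cell `pub-balaban`, sub-cell `t4`, spine estimate NE7b (`T4WeightBudget.RelWeightBound`; the cell's OWN estimate — NOT PRINTED in
[Bałaban 1983–89], NOT PROVED).  Crux-route work under `Spine/NE7b/` by the row OWNER (`t4-ne7b-p1` gen 146, file (734)) under FREEZE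
(0)'s crux-prover clause; NOTHING of Bałaban's is named as a Lean object, valued or asserted; no `T4Continuum/Support` leaf typed; no
`def`, no notation (`M₅′`'s terms WRITTEN OUT as printed by (687)); zero `sorry`.  Imports (BY NAME): (656), (700) ((691), (689), (653),
(649) through them), (538) (`sum4_rot3∕4`).

WHAT IS PROVED ([folklore]): **`output_k5ϑ_s_part6`**; toy.

HONEST (what this is NOT).  One slot (part) of five; hypotheses = the weighted-class letters of SCOPING-d17 §D∕§F at order five (rates `ϑ⁴ ≤ ϑ₂`,
`ϑ⁶ ≤ σσ`, `ϑ ≤ r₁`, `Σϑ⁸∕ϑ₂, Σϑ⁶∕√ρ, Σϑ²∕r₁ < ∞`); the `K5` profile discharges and the packaging are later files; scalar skeleton ((A3),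
NC-NE7b-α UNRULED); nothing of Bałaban's asserted.  BY-NAME EFFECT ON THE WALL: NONE.  NE7b NOT PRINTED ∕ NOT PROVED; spine PROVED 0∕9; rung
(B)+1 — the programme's measures remain FINITE-torus statements; NOT the mass gap, NOT Clay.  HONEST DEPENDENCY: continuum YM on T⁴ ⇐ BetaPertH
∧ nine spine estimates (0∕9 proved); BetaPertH ⇐ (D1) ∧ (D4) ∧ CAP+tail; G-an2-4 gates asym, D1 and NE2∕3∕4.
-/

set_option autoImplicit false

noncomputable section

namespace Summit.QuantumFields.BalabanUV.T4Continuum.NE7b.SupWeightedFifthOrderLettersFivePart6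

open Finset Real
open scoped BigOperators
open SupWeightedSlotTools (sum_sqrt_mul_le_letters)
open SupWeightedTwoPointMasters (weighted_two_point_family_le weighted_two_point_family_le')
open SupWeightedTwoPointMastersTwo (weighted_two_point_two_families_le weighted_two_point_two_families_le')
open SupWeightedFivePointTools
open SupWeightedFivePointToolsTwo (rmono smono tmono pmono geom2 sum2_sqrt_mul_le_letters' absorb_le_one mul_le_one_of sqrt_split3
  sqrt_split4 sqrt_split_tree)
open SupWeightedFivePointToolsThree (pmono_first pmono_second geom_first geom_second)
open SupFivePointGreedyRowSum (sum4_rot3 sum4_rot4)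

variable {ι κ : Type} [Fintype ι] [Fintype κ]

variable {Hk : ι → ι → ℝ} {K3 : ι → ι → ι → ℝ} {K4 : ι → ι → ι → ι → ℝ} {K5 : ι → ι → ι → ι → ι → ℝ} {A : Matrix ι κ ℝ} {D : κ → κ → ℝ}
  {ϑ ϑ₂ ρ r₁ : ι → ι → ℝ} {σ : ι → κ → ℝ} {θ : κ → κ → ℝ}
  {κ₂ γop lam lamA C3k C3h C4 C5 dθ dθ' αθ αθc αg1m αg2m αg1c αk4m1 αk4m2 αk4m3 αk4c αk5m1 αk5m2 αk5m3 αk5m4 αk5c hrϑ hcϑ k3rϑ k3mϑ k3cϑ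
    k5ϑ1 k5ϑ2 k5ϑ3 k5ϑ4 k5ϑ5 G Θ8 S2 : ℝ}

set_option maxHeartbeats 1600000 in
/-- **WEIGHTED FIFTH-ORDER SLOT LETTER, `s` FIXED, PART 6 OF 8**: terms `39, 40, 41, 42, 43, 44, 45` of `M₅′` ((687)) summed over
the four free indices against the full-graph weight `Π_{10 pairs}ϑ`. [folklore] -/
theorem output_k5ϑ_s_part6 (hK30 : ∀ a b u, 0 ≤ K3 a b u) (hHk0 : ∀ v u, 0 ≤ Hk v u) (hϑ1 : ∀ x y, 1 ≤ ϑ x y) (hϑsymm : ∀ x y, ϑ x y = ϑ y x)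
    (hϑmul : ∀ x y z, ϑ x z ≤ ϑ x y * ϑ y z) (hϑ4 : ∀ x y, ϑ x y ^ 4 ≤ ϑ₂ x y) (hϑ₂symm : ∀ x y, ϑ₂ x y = ϑ₂ y x) (hρ0 : ∀ x y, 0 < ρ x y)
    (hρsymm : ∀ x y, ρ x y = ρ y x) (hr0 : ∀ x y, 0 < r₁ x y) (hr₁symm : ∀ x y, r₁ x y = r₁ y x) (hϑr₁ : ∀ x y, ϑ x y ≤ r₁ x y)
    (hG : ∀ a, ∑ b, ϑ a b ^ 6 / Real.sqrt (ρ a b) ≤ G) (hΘ : ∀ a, ∑ b, (ϑ a b ^ 4) ^ 2 / ϑ₂ a b ≤ Θ8) (hS2 : ∀ a, ∑ b, ϑ a b ^ 2 / r₁ a b ≤ S2)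
    (hhr : ∀ v, ∑ u, ϑ₂ v u * Hk v u ≤ hrϑ) (hhc : ∀ a, ∑ b, ϑ₂ a b * Hk b a ≤ hcϑ)
    (hk3m : ∀ y, ∑ x, ∑ v, K3 x y v * (ϑ₂ y x * ϑ₂ y v * ϑ₂ x v) ≤ k3mϑ)
    (s : ι) :
    ∑ x, ∑ y, ∑ z, ∑ t,
        ((Real.sqrt (4 * Hk y x * Hk s z * Real.sqrt (Real.sqrt (5 * (κ₂ ^ 4 * γop ^ 2) / (1 - lam * γop) ^ 2)) * C3h) / Real.sqrt (ρ x z * ρ x t)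
            : ℝ) + (Real.sqrt (2 * K3 z s x * Real.sqrt (5 * (κ₂ ^ 4 * γop ^ 2) / (1 - lam * γop) ^ 2) * C3k) / Real.sqrt (ρ x y * ρ x t) : ℝ) +
          (Real.sqrt (4 * Hk t x * Hk s z * Real.sqrt (Real.sqrt (5 * (κ₂ ^ 4 * γop ^ 2) / (1 - lam * γop) ^ 2)) * C3h) / Real.sqrt
            (ρ x z * ρ x y) : ℝ) +
          (Real.sqrt
            (16 *
              (8 * Hk s z *
                (Real.sqrt (5 * (κ₂ ^ 4 * γop ^ 2) / (1 - lam * γop) ^ 2) * Real.sqrt (Real.sqrt (5 * (κ₂ ^ 4 * γop ^ 2) / (1 - lam * γop) ^ 2)))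
                * C4)) * ((r₁ x z)⁻¹ * (r₁ x y)⁻¹ * (r₁ x t)⁻¹ * (r₁ z y)⁻¹ * (r₁ z t)⁻¹ * (r₁ y t)⁻¹) : ℝ) +
          (Real.sqrt (4 * Hk y x * Hk s t * Real.sqrt (Real.sqrt (5 * (κ₂ ^ 4 * γop ^ 2) / (1 - lam * γop) ^ 2)) * C3h) / Real.sqrt
            (ρ x t * ρ x z) : ℝ) +
          (Real.sqrt (2 * K3 t s x * Real.sqrt (5 * (κ₂ ^ 4 * γop ^ 2) / (1 - lam * γop) ^ 2) * C3k) / Real.sqrt (ρ x y * ρ x z) : ℝ) +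
          (Real.sqrt (4 * Hk z x * Hk s t * Real.sqrt (Real.sqrt (5 * (κ₂ ^ 4 * γop ^ 2) / (1 - lam * γop) ^ 2)) * C3h) / Real.sqrt
            (ρ x t * ρ x y) : ℝ)) * (ϑ x y * ϑ x z * ϑ x t * ϑ x s * ϑ y z * ϑ y t * ϑ y s * ϑ z t * ϑ z s * ϑ t s) ≤
      Real.sqrt (4 * Real.sqrt (Real.sqrt (5 * (κ₂ ^ 4 * γop ^ 2) / (1 - lam * γop) ^ 2)) * C3h) *
          (Real.sqrt (hrϑ * Θ8) * (G * (Real.sqrt (hcϑ * Θ8) * G))) + Real.sqrt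
          (2 * Real.sqrt (5 * (κ₂ ^ 4 * γop ^ 2) / (1 - lam * γop) ^ 2) * C3k) * (Real.sqrt (k3mϑ * (Θ8 * Θ8)) * (G * G)) + Real.sqrt
          (4 * Real.sqrt (Real.sqrt (5 * (κ₂ ^ 4 * γop ^ 2) / (1 - lam * γop) ^ 2)) * C3h) *
          (Real.sqrt (hrϑ * Θ8) * (G * (G * Real.sqrt (hcϑ * Θ8)))) + Real.sqrt
          (16 *
            (8 * (Real.sqrt (5 * (κ₂ ^ 4 * γop ^ 2) / (1 - lam * γop) ^ 2) * Real.sqrt (Real.sqrt (5 * (κ₂ ^ 4 * γop ^ 2) / (1 - lam * γop) ^ 2)))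
              * C4)) * (Real.sqrt (hrϑ * Θ8) * (S2 * (S2 * S2))) + Real.sqrt
          (4 * Real.sqrt (Real.sqrt (5 * (κ₂ ^ 4 * γop ^ 2) / (1 - lam * γop) ^ 2)) * C3h) *
          (Real.sqrt (hrϑ * Θ8) * (G * (Real.sqrt (hcϑ * Θ8) * G))) + Real.sqrt
          (2 * Real.sqrt (5 * (κ₂ ^ 4 * γop ^ 2) / (1 - lam * γop) ^ 2) * C3k) * (Real.sqrt (k3mϑ * (Θ8 * Θ8)) * (G * G)) + Real.sqrt
          (4 * Real.sqrt (Real.sqrt (5 * (κ₂ ^ 4 * γop ^ 2) / (1 - lam * γop) ^ 2)) * C3h) *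
          (Real.sqrt (hrϑ * Θ8) * (G * (G * Real.sqrt (hcϑ * Θ8)))) := by
  generalize Real.sqrt (5 * (κ₂ ^ 4 * γop ^ 2) / (1 - lam * γop) ^ 2) = sV
  have h0 : ∀ a b, 0 ≤ ϑ a b := fun a b => zero_le_one.trans (hϑ1 a b)
  have h1 : ∀ a b, 1 ≤ ϑ a b := hϑ1
  have hϑ2k : ∀ a b (k : ℕ), k ≤ 4 → ϑ a b ^ k ≤ ϑ₂ a b := fun a b k hk => (pow_le_pow_right₀ (hϑ1 a b) hk).trans (hϑ4 a b)
  have hϑ₂0 : ∀ a b, 0 ≤ ϑ₂ a b := fun a b => (pow_nonneg (h0 a b) 4).trans (hϑ4 a b)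
  have hϑ₂pos : ∀ a b, 0 < ϑ₂ a b := fun a b => lt_of_lt_of_le (pow_pos (lt_of_lt_of_le one_pos (hϑ1 a b)) 4) (hϑ4 a b)
  have hsy : ∀ a b, ϑ a b = ϑ b a := hϑsymm
  have hm00 : ∀ a c b, ϑ a b ≤ ϑ a c * ϑ c b := fun a c b => hϑmul a c b
  have hm10 : ∀ a c b, ϑ a b ≤ ϑ c a * ϑ c b := fun a c b => by rw [hϑsymm c a]; exact hϑmul a c b
  have hϑsq : ∀ a b (k : ℕ), k * 2 ≤ 4 → (ϑ a b ^ k) ^ 2 ≤ ϑ₂ a b := fun a b k hk => by rw [← pow_mul]; exact hϑ2k a b (k * 2) hk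
  have tnn : ∀ a b, 0 ≤ (ϑ a b ^ 4) ^ 2 / ϑ₂ a b := fun a b => div_nonneg (pow_nonneg (pow_nonneg (h0 a b) 4) 2) (hϑ₂0 a b)
  have hT0 : 0 ≤ Θ8 := le_trans (Finset.sum_nonneg fun b _ => tnn s b) (hΘ s)
  have hG0 : 0 ≤ G := le_trans (Finset.sum_nonneg fun b _ => div_nonneg (pow_nonneg (h0 _ _) 6) (Real.sqrt_nonneg _)) (hG s)
  have hS20 : 0 ≤ S2 := le_trans (Finset.sum_nonneg fun b _ => div_nonneg (pow_nonneg (h0 _ _) 2) (hr0 _ _).le) (hS2 s)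
  have hΘsy : ∀ a, ∑ b, (ϑ b a ^ 4) ^ 2 / ϑ₂ b a ≤ Θ8 := fun a => by simp_rw [hϑsymm _ a, hϑ₂symm _ a]; exact hΘ a
  have hGsy : ∀ a, ∑ b, ϑ a b ^ 6 / Real.sqrt (ρ b a) ≤ G := fun a => by simp_rw [hρsymm _ a]; exact hG a
  have hS2sy : ∀ a, ∑ b, ϑ a b ^ 2 / r₁ b a ≤ S2 := fun a => by simp_rw [hr₁symm _ a]; exact hS2 a
  have tm39 : ∑ x, ∑ y, ∑ z, ∑ t, ((Real.sqrt (4 * Hk y x * Hk s z * Real.sqrt (sV) * C3h) / Real.sqrt (ρ x z * ρ x t) : ℝ)) *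
      (ϑ x y * ϑ x z * ϑ x t * ϑ x s * ϑ y z * ϑ y t * ϑ y s * ϑ z t * ϑ z s * ϑ t s) ≤ Real.sqrt (4 * Real.sqrt (sV) * C3h) *
      (Real.sqrt (hrϑ * Θ8) * (G * (Real.sqrt (hcϑ * Θ8) * G))) := by
    have hw : ∀ x y z t : ι, ϑ x y * ϑ x z * ϑ x t * ϑ x s * ϑ y z * ϑ y t * ϑ y s * ϑ z t * ϑ z s * ϑ t s ≤ ϑ x y ^ 4 * ϑ z x ^ 6 * ϑ x t ^ 4 * ϑ
        s z ^ 4 := fun x y z t =>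
      (prod10_le le_rfl ((hsy x z).le) le_rfl (((hm10 x z s).trans (mul_le_mul_of_nonneg_left (hsy z s).le (h0 _ _))))
            (((hm10 y x z).trans (mul_le_mul_of_nonneg_left (hsy x z).le (h0 _ _)))) ((hm10 y x t))
            (((hm10 y x s).trans (mul_le_mul_of_nonneg_left ((hm10 x z s).trans (mul_le_mul_of_nonneg_left (hsy z s).le (h0 _ _))) (h0 _ _))))
            ((hm00 z x t)) ((hsy z s).le)
            (((hm10 t x s).trans (mul_le_mul_of_nonneg_left ((hm10 x z s).trans (mul_le_mul_of_nonneg_left (hsy z s).le (h0 _ _))) (h0 _ _))))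
            (h0 _ _) (h0 _ _) (h0 _ _) (h0 _ _) (h0 _ _) (h0 _ _) (h0 _ _) (h0 _ _) (h0 _ _) (h0 _ _)).trans_eq (by ring)
    refine (sum4_rot3 _).trans_le ?_
    have hKK0 : 0 ≤ Real.sqrt (4 * Real.sqrt (sV) * C3h) := (Real.sqrt_nonneg _)
    have hpw : ∀ x y z t : ι, ((Real.sqrt (4 * Hk y x * Hk s z * Real.sqrt (sV) * C3h) / Real.sqrt (ρ x z * ρ x t) : ℝ)) *
        (ϑ x y * ϑ x z * ϑ x t * ϑ x s * ϑ y z * ϑ y t * ϑ y s * ϑ z t * ϑ z s * ϑ t s) ≤ Real.sqrt (4 * Real.sqrt (sV) * C3h) *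
        (Real.sqrt (Hk s z) * ϑ s z ^ 4 * ((ϑ z x ^ 6 / Real.sqrt (ρ x z)) * ((Real.sqrt (Hk y x) * ϑ x y ^ 4) * (ϑ x t ^ 4 / Real.sqrt (ρ x t)))))
        := fun x y z t =>
      (mul_le_mul_of_nonneg_left (hw x y z t) (div_nonneg (Real.sqrt_nonneg _) (Real.sqrt_nonneg _))).trans_eq
          (by rw [sqrt_split4 (hHk0 y x) (hHk0 s z), Real.sqrt_mul (hρ0 x z).le]; ring)
    refine le_trans
        (Finset.sum_le_sum fun z _ => Finset.sum_le_sum fun x _ => Finset.sum_le_sum fun y _ => Finset.sum_le_sum fun t _ => hpw x y z t) ?_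
    exact sum4_le (K := Real.sqrt (4 * Real.sqrt (sV) * C3h)) (a := fun z => Real.sqrt (Hk s z) * ϑ s z ^ 4)
        (b := fun z x => ϑ z x ^ 6 / Real.sqrt (ρ x z)) (c := fun z x y => Real.sqrt (Hk y x) * ϑ x y ^ 4)
        (d := fun z x y t => ϑ x t ^ 4 / Real.sqrt (ρ x t)) hKK0 (fun z => (mul_nonneg (Real.sqrt_nonneg _) (pow_nonneg (h0 _ _) _)))
        (fun z x => (div_nonneg (pow_nonneg (h0 _ _) _) (Real.sqrt_nonneg _)))
        (fun z x y => (mul_nonneg (Real.sqrt_nonneg _) (pow_nonneg (h0 _ _) _))) hG0 (Real.sqrt_nonneg _) hG0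
        (sum_sqrt_mul_le_letters Finset.univ (a := fun z => Hk s z) (c := fun z => ϑ s z ^ 4) (θ := fun z => ϑ₂ s z) (fun z => hHk0 _ _)
          (fun z => pow_nonneg (h0 _ _) _) (fun z => hϑ₂pos _ _) (hhr s)
          ((Finset.sum_le_sum fun z _ => tmono (h1 s z) (hϑ₂pos s z) (by norm_num : 4 ≤ 4)).trans (hΘ s)))
        (fun z => ((Finset.sum_le_sum fun x _ => rmono (h1 z x) (hρ0 x z) (by norm_num : 6 ≤ 6)).trans (hGsy z)))
        (fun z x =>
          (sum_sqrt_mul_le_letters Finset.univ (a := fun y => Hk y x) (c := fun y => ϑ x y ^ 4) (θ := fun y => ϑ₂ x y) (fun y => hHk0 _ _)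
            (fun y => pow_nonneg (h0 _ _) _) (fun y => hϑ₂pos _ _) (hhc x)
            ((Finset.sum_le_sum fun y _ => tmono (h1 x y) (hϑ₂pos x y) (by norm_num : 4 ≤ 4)).trans (hΘ x))))
        (fun z x y => ((Finset.sum_le_sum fun t _ => rmono (h1 x t) (hρ0 x t) (by norm_num : 4 ≤ 6)).trans (hG x)))
  have tm40 : ∑ x, ∑ y, ∑ z, ∑ t, ((Real.sqrt (2 * K3 z s x * sV * C3k) / Real.sqrt (ρ x y * ρ x t) : ℝ)) *
      (ϑ x y * ϑ x z * ϑ x t * ϑ x s * ϑ y z * ϑ y t * ϑ y s * ϑ z t * ϑ z s * ϑ t s) ≤ Real.sqrt (2 * sV * C3k) *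
      (Real.sqrt (k3mϑ * (Θ8 * Θ8)) * (G * G)) := by
    have hw : ∀ x y z t : ι, ϑ x y * ϑ x z * ϑ x t * ϑ x s * ϑ y z * ϑ y t * ϑ y s * ϑ z t * ϑ z s * ϑ t s ≤ ϑ x y ^ 4 * ϑ z x ^ 3 * ϑ x t ^ 4 * ϑ
        s x ^ 3 * ϑ s z ^ 1 := fun x y z t =>
      (prod10_le le_rfl ((hsy x z).le) le_rfl ((hsy x s).le) (((hm10 y x z).trans (mul_le_mul_of_nonneg_left (hsy x z).le (h0 _ _))))
            ((hm10 y x t)) (((hm10 y x s).trans (mul_le_mul_of_nonneg_left (hsy x s).le (h0 _ _)))) ((hm00 z x t)) ((hsy z s).le)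
            (((hm10 t x s).trans (mul_le_mul_of_nonneg_left (hsy x s).le (h0 _ _)))) (h0 _ _) (h0 _ _) (h0 _ _) (h0 _ _) (h0 _ _) (h0 _ _)
            (h0 _ _) (h0 _ _) (h0 _ _) (h0 _ _)).trans_eq (by ring)
    refine (sum4_rot3 _).trans_le ?_
    have hKK0 : 0 ≤ Real.sqrt (2 * sV * C3k) := (Real.sqrt_nonneg _)
    have hpw : ∀ x y z t : ι, ((Real.sqrt (2 * K3 z s x * sV * C3k) / Real.sqrt (ρ x y * ρ x t) : ℝ)) *
        (ϑ x y * ϑ x z * ϑ x t * ϑ x s * ϑ y z * ϑ y t * ϑ y s * ϑ z t * ϑ z s * ϑ t s) ≤ Real.sqrt (2 * sV * C3k) *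
        (Real.sqrt (K3 z s x) * (ϑ s z ^ 1 * ϑ s x ^ 3 * ϑ z x ^ 3) * ((ϑ x y ^ 4 / Real.sqrt (ρ x y)) * (ϑ x t ^ 4 / Real.sqrt (ρ x t)))) := fun
        x y z t =>
      (mul_le_mul_of_nonneg_left (hw x y z t) (div_nonneg (Real.sqrt_nonneg _) (Real.sqrt_nonneg _))).trans_eq
          (by rw [sqrt_split3 (hK30 z s x), Real.sqrt_mul (hρ0 x y).le]; ring)
    refine le_trans
        (Finset.sum_le_sum fun z _ => Finset.sum_le_sum fun x _ => Finset.sum_le_sum fun y _ => Finset.sum_le_sum fun t _ => hpw x y z t) ?_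
    exact sum4_le_pair_first (K := Real.sqrt (2 * sV * C3k)) (e := fun z x => Real.sqrt (K3 z s x) * (ϑ s z ^ 1 * ϑ s x ^ 3 * ϑ z x ^ 3))
        (a := fun z x y => ϑ x y ^ 4 / Real.sqrt (ρ x y)) (b := fun z x y t => ϑ x t ^ 4 / Real.sqrt (ρ x t)) hKK0
        (fun z x =>
          (mul_nonneg (Real.sqrt_nonneg _) (mul_nonneg (mul_nonneg (pow_nonneg (h0 _ _) _) (pow_nonneg (h0 _ _) _)) (pow_nonneg (h0 _ _) _))))
        (fun z x y => (div_nonneg (pow_nonneg (h0 _ _) _) (Real.sqrt_nonneg _))) hG0 hG0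
        (sum2_sqrt_mul_le_letters' (a := fun z x => K3 z s x) (c := fun z x => ϑ s z ^ 1 * ϑ s x ^ 3 * ϑ z x ^ 3)
          (θ := fun z x => ϑ₂ s z * ϑ₂ s x * ϑ₂ z x) (fun z x => hK30 _ _ _)
          (fun z x => mul_nonneg (mul_nonneg (pow_nonneg (h0 _ _) _) (pow_nonneg (h0 _ _) _)) (pow_nonneg (h0 _ _) _))
          (fun z x => mul_pos (mul_pos (hϑ₂pos _ _) (hϑ₂pos _ _)) (hϑ₂pos _ _)) (hk3m s)
          ((Finset.sum_le_sum fun z _ => Finset.sum_le_sum fun x _ => pmono_first (h1 s z) (h1 s x) (h1 z x) (hϑ₂pos s z) (hϑ₂pos s x)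
              (hϑ₂pos z x) (hϑsq s z 1 (by norm_num)) (by norm_num : 3 ≤ 4) (by norm_num : 3 ≤ 4)).trans
            (geom_first (fun x => tnn s x) (fun x => hΘsy x) (hΘ s) hT0)))
        (fun z x => ((Finset.sum_le_sum fun y _ => rmono (h1 x y) (hρ0 x y) (by norm_num : 4 ≤ 6)).trans (hG x)))
        (fun z x y => ((Finset.sum_le_sum fun t _ => rmono (h1 x t) (hρ0 x t) (by norm_num : 4 ≤ 6)).trans (hG x)))
  have tm41 : ∑ x, ∑ y, ∑ z, ∑ t, ((Real.sqrt (4 * Hk t x * Hk s z * Real.sqrt (sV) * C3h) / Real.sqrt (ρ x z * ρ x y) : ℝ)) *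
      (ϑ x y * ϑ x z * ϑ x t * ϑ x s * ϑ y z * ϑ y t * ϑ y s * ϑ z t * ϑ z s * ϑ t s) ≤ Real.sqrt (4 * Real.sqrt (sV) * C3h) *
      (Real.sqrt (hrϑ * Θ8) * (G * (G * Real.sqrt (hcϑ * Θ8)))) := by
    have hw : ∀ x y z t : ι, ϑ x y * ϑ x z * ϑ x t * ϑ x s * ϑ y z * ϑ y t * ϑ y s * ϑ z t * ϑ z s * ϑ t s ≤ ϑ x y ^ 4 * ϑ z x ^ 6 * ϑ x t ^ 4 * ϑ
        s z ^ 4 := fun x y z t =>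
      (prod10_le le_rfl ((hsy x z).le) le_rfl (((hm10 x z s).trans (mul_le_mul_of_nonneg_left (hsy z s).le (h0 _ _))))
            (((hm10 y x z).trans (mul_le_mul_of_nonneg_left (hsy x z).le (h0 _ _)))) ((hm10 y x t))
            (((hm10 y x s).trans (mul_le_mul_of_nonneg_left ((hm10 x z s).trans (mul_le_mul_of_nonneg_left (hsy z s).le (h0 _ _))) (h0 _ _))))
            ((hm00 z x t)) ((hsy z s).le)
            (((hm10 t x s).trans (mul_le_mul_of_nonneg_left ((hm10 x z s).trans (mul_le_mul_of_nonneg_left (hsy z s).le (h0 _ _))) (h0 _ _))))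
            (h0 _ _) (h0 _ _) (h0 _ _) (h0 _ _) (h0 _ _) (h0 _ _) (h0 _ _) (h0 _ _) (h0 _ _) (h0 _ _)).trans_eq (by ring)
    refine (sum4_rot3 _).trans_le ?_
    have hKK0 : 0 ≤ Real.sqrt (4 * Real.sqrt (sV) * C3h) := (Real.sqrt_nonneg _)
    have hpw : ∀ x y z t : ι, ((Real.sqrt (4 * Hk t x * Hk s z * Real.sqrt (sV) * C3h) / Real.sqrt (ρ x z * ρ x y) : ℝ)) *
        (ϑ x y * ϑ x z * ϑ x t * ϑ x s * ϑ y z * ϑ y t * ϑ y s * ϑ z t * ϑ z s * ϑ t s) ≤ Real.sqrt (4 * Real.sqrt (sV) * C3h) *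
        (Real.sqrt (Hk s z) * ϑ s z ^ 4 * ((ϑ z x ^ 6 / Real.sqrt (ρ x z)) * ((ϑ x y ^ 4 / Real.sqrt (ρ x y)) * (Real.sqrt (Hk t x) * ϑ x t ^ 4))))
        := fun x y z t =>
      (mul_le_mul_of_nonneg_left (hw x y z t) (div_nonneg (Real.sqrt_nonneg _) (Real.sqrt_nonneg _))).trans_eq
          (by rw [sqrt_split4 (hHk0 t x) (hHk0 s z), Real.sqrt_mul (hρ0 x z).le]; ring)
    refine le_trans
        (Finset.sum_le_sum fun z _ => Finset.sum_le_sum fun x _ => Finset.sum_le_sum fun y _ => Finset.sum_le_sum fun t _ => hpw x y z t) ?_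
    exact sum4_le (K := Real.sqrt (4 * Real.sqrt (sV) * C3h)) (a := fun z => Real.sqrt (Hk s z) * ϑ s z ^ 4)
        (b := fun z x => ϑ z x ^ 6 / Real.sqrt (ρ x z)) (c := fun z x y => ϑ x y ^ 4 / Real.sqrt (ρ x y))
        (d := fun z x y t => Real.sqrt (Hk t x) * ϑ x t ^ 4) hKK0 (fun z => (mul_nonneg (Real.sqrt_nonneg _) (pow_nonneg (h0 _ _) _)))
        (fun z x => (div_nonneg (pow_nonneg (h0 _ _) _) (Real.sqrt_nonneg _)))
        (fun z x y => (div_nonneg (pow_nonneg (h0 _ _) _) (Real.sqrt_nonneg _))) hG0 hG0 (Real.sqrt_nonneg _)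
        (sum_sqrt_mul_le_letters Finset.univ (a := fun z => Hk s z) (c := fun z => ϑ s z ^ 4) (θ := fun z => ϑ₂ s z) (fun z => hHk0 _ _)
          (fun z => pow_nonneg (h0 _ _) _) (fun z => hϑ₂pos _ _) (hhr s)
          ((Finset.sum_le_sum fun z _ => tmono (h1 s z) (hϑ₂pos s z) (by norm_num : 4 ≤ 4)).trans (hΘ s)))
        (fun z => ((Finset.sum_le_sum fun x _ => rmono (h1 z x) (hρ0 x z) (by norm_num : 6 ≤ 6)).trans (hGsy z)))
        (fun z x => ((Finset.sum_le_sum fun y _ => rmono (h1 x y) (hρ0 x y) (by norm_num : 4 ≤ 6)).trans (hG x)))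
        (fun z x y =>
          (sum_sqrt_mul_le_letters Finset.univ (a := fun t => Hk t x) (c := fun t => ϑ x t ^ 4) (θ := fun t => ϑ₂ x t) (fun t => hHk0 _ _)
            (fun t => pow_nonneg (h0 _ _) _) (fun t => hϑ₂pos _ _) (hhc x)
            ((Finset.sum_le_sum fun t _ => tmono (h1 x t) (hϑ₂pos x t) (by norm_num : 4 ≤ 4)).trans (hΘ x))))
  have tm42 : ∑ x, ∑ y, ∑ z, ∑ t,
      ((Real.sqrt (16 * (8 * Hk s z * (sV * Real.sqrt (sV)) * C4)) * ((r₁ x z)⁻¹ * (r₁ x y)⁻¹ * (r₁ x t)⁻¹ * (r₁ z y)⁻¹ * (r₁ z t)⁻¹ * (r₁ y t)⁻¹)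
        : ℝ)) * (ϑ x y * ϑ x z * ϑ x t * ϑ x s * ϑ y z * ϑ y t * ϑ y s * ϑ z t * ϑ z s * ϑ t s) ≤ Real.sqrt
      (16 * (8 * (sV * Real.sqrt (sV)) * C4)) * (Real.sqrt (hrϑ * Θ8) * (S2 * (S2 * S2))) := by
    have hw : ∀ x y z t : ι, ϑ x y * ϑ x z * ϑ x t * ϑ x s * ϑ y z * ϑ y t * ϑ y s * ϑ z t * ϑ z s * ϑ t s ≤ ϑ z x ^ 2 * ϑ z y ^ 2 * ϑ z t ^ 2 * ϑ
        s z ^ 4 * ϑ x y * ϑ x t * ϑ y t := fun x y z t =>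
      (prod10_le le_rfl ((hsy x z).le) le_rfl (((hm10 x z s).trans (mul_le_mul_of_nonneg_left (hsy z s).le (h0 _ _)))) ((hsy y z).le) le_rfl
            (((hm10 y z s).trans (mul_le_mul_of_nonneg_left (hsy z s).le (h0 _ _)))) le_rfl ((hsy z s).le)
            (((hm10 t z s).trans (mul_le_mul_of_nonneg_left (hsy z s).le (h0 _ _)))) (h0 _ _) (h0 _ _) (h0 _ _) (h0 _ _) (h0 _ _) (h0 _ _)
            (h0 _ _) (h0 _ _) (h0 _ _) (h0 _ _)).trans_eq (by ring)
    refine (sum4_rot3 _).trans_le ?_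
    have hKK0 : 0 ≤ Real.sqrt (16 * (8 * (sV * Real.sqrt (sV)) * C4)) := (Real.sqrt_nonneg _)
    have hpw : ∀ x y z t : ι,
        ((Real.sqrt (16 * (8 * Hk s z * (sV * Real.sqrt (sV)) * C4)) *
          ((r₁ x z)⁻¹ * (r₁ x y)⁻¹ * (r₁ x t)⁻¹ * (r₁ z y)⁻¹ * (r₁ z t)⁻¹ * (r₁ y t)⁻¹) : ℝ)) *
        (ϑ x y * ϑ x z * ϑ x t * ϑ x s * ϑ y z * ϑ y t * ϑ y s * ϑ z t * ϑ z s * ϑ t s) ≤ Real.sqrt (16 * (8 * (sV * Real.sqrt (sV)) * C4)) *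
        (Real.sqrt (Hk s z) * ϑ s z ^ 4 * ((ϑ z x ^ 2 * (r₁ x z)⁻¹) * ((ϑ z y ^ 2 * (r₁ z y)⁻¹) * (ϑ z t ^ 2 * (r₁ z t)⁻¹)))) := fun x y z t =>
      (mul_le_mul_of_nonneg_left (hw x y z t)
            (mul_nonneg (Real.sqrt_nonneg _)
              (mul_nonneg
                (mul_nonneg
                  (mul_nonneg (mul_nonneg (mul_nonneg (inv_nonneg.2 (hr0 _ _).le) (inv_nonneg.2 (hr0 _ _).le)) (inv_nonneg.2 (hr0 _ _).le))
                    (inv_nonneg.2 (hr0 _ _).le)) (inv_nonneg.2 (hr0 _ _).le)) (inv_nonneg.2 (hr0 _ _).le)))).trans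
          (Eq.trans_le (by rw [sqrt_split_tree (hHk0 s z)]; ring)
            (mul_le_of_le_one_right
              (mul_nonneg hKK0
                (mul_nonneg (mul_nonneg (Real.sqrt_nonneg _) (pow_nonneg (h0 _ _) _))
                  (mul_nonneg (mul_nonneg (pow_nonneg (h0 _ _) _) (inv_nonneg.2 (hr0 _ _).le))
                    (mul_nonneg (mul_nonneg (pow_nonneg (h0 _ _) _) (inv_nonneg.2 (hr0 _ _).le))
                      (mul_nonneg (pow_nonneg (h0 _ _) _) (inv_nonneg.2 (hr0 _ _).le))))))
              (mul_le_one_of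
                (mul_le_one_of (absorb_le_one (hϑr₁ x y) (hr0 x y)) (mul_nonneg (h0 _ _) (inv_nonneg.2 (hr0 _ _).le))
                  (absorb_le_one (hϑr₁ x t) (hr0 x t))) (mul_nonneg (h0 _ _) (inv_nonneg.2 (hr0 _ _).le)) (absorb_le_one (hϑr₁ y t) (hr0 y t)))))
    refine le_trans
        (Finset.sum_le_sum fun z _ => Finset.sum_le_sum fun x _ => Finset.sum_le_sum fun y _ => Finset.sum_le_sum fun t _ => hpw x y z t) ?_
    exact sum4_le (K := Real.sqrt (16 * (8 * (sV * Real.sqrt (sV)) * C4))) (a := fun z => Real.sqrt (Hk s z) * ϑ s z ^ 4)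
        (b := fun z x => ϑ z x ^ 2 * (r₁ x z)⁻¹) (c := fun z x y => ϑ z y ^ 2 * (r₁ z y)⁻¹) (d := fun z x y t => ϑ z t ^ 2 * (r₁ z t)⁻¹) hKK0
        (fun z => (mul_nonneg (Real.sqrt_nonneg _) (pow_nonneg (h0 _ _) _)))
        (fun z x => (mul_nonneg (pow_nonneg (h0 _ _) _) (inv_nonneg.2 (hr0 _ _).le)))
        (fun z x y => (mul_nonneg (pow_nonneg (h0 _ _) _) (inv_nonneg.2 (hr0 _ _).le))) hS20 hS20 hS20
        (sum_sqrt_mul_le_letters Finset.univ (a := fun z => Hk s z) (c := fun z => ϑ s z ^ 4) (θ := fun z => ϑ₂ s z) (fun z => hHk0 _ _)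
          (fun z => pow_nonneg (h0 _ _) _) (fun z => hϑ₂pos _ _) (hhr s)
          ((Finset.sum_le_sum fun z _ => tmono (h1 s z) (hϑ₂pos s z) (by norm_num : 4 ≤ 4)).trans (hΘ s)))
        (fun z => ((Finset.sum_le_sum fun x _ => smono (h1 z x) (hr0 x z) (by norm_num : 2 ≤ 2)).trans (hS2sy z)))
        (fun z x => ((Finset.sum_le_sum fun y _ => smono (h1 z y) (hr0 z y) (by norm_num : 2 ≤ 2)).trans (hS2 z)))
        (fun z x y => ((Finset.sum_le_sum fun t _ => smono (h1 z t) (hr0 z t) (by norm_num : 2 ≤ 2)).trans (hS2 z)))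
  have tm43 : ∑ x, ∑ y, ∑ z, ∑ t, ((Real.sqrt (4 * Hk y x * Hk s t * Real.sqrt (sV) * C3h) / Real.sqrt (ρ x t * ρ x z) : ℝ)) *
      (ϑ x y * ϑ x z * ϑ x t * ϑ x s * ϑ y z * ϑ y t * ϑ y s * ϑ z t * ϑ z s * ϑ t s) ≤ Real.sqrt (4 * Real.sqrt (sV) * C3h) *
      (Real.sqrt (hrϑ * Θ8) * (G * (Real.sqrt (hcϑ * Θ8) * G))) := by
    have hw : ∀ x y z t : ι, ϑ x y * ϑ x z * ϑ x t * ϑ x s * ϑ y z * ϑ y t * ϑ y s * ϑ z t * ϑ z s * ϑ t s ≤ ϑ x y ^ 4 * ϑ x z ^ 4 * ϑ t x ^ 6 * ϑ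
        s t ^ 4 := fun x y z t =>
      (prod10_le le_rfl le_rfl ((hsy x t).le) (((hm10 x t s).trans (mul_le_mul_of_nonneg_left (hsy t s).le (h0 _ _)))) ((hm10 y x z))
            (((hm10 y x t).trans (mul_le_mul_of_nonneg_left (hsy x t).le (h0 _ _))))
            (((hm10 y x s).trans (mul_le_mul_of_nonneg_left ((hm10 x t s).trans (mul_le_mul_of_nonneg_left (hsy t s).le (h0 _ _))) (h0 _ _))))
            (((hm10 z x t).trans (mul_le_mul_of_nonneg_left (hsy x t).le (h0 _ _))))
            (((hm10 z x s).trans (mul_le_mul_of_nonneg_left ((hm10 x t s).trans (mul_le_mul_of_nonneg_left (hsy t s).le (h0 _ _))) (h0 _ _))))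
            ((hsy t s).le) (h0 _ _) (h0 _ _) (h0 _ _) (h0 _ _) (h0 _ _) (h0 _ _) (h0 _ _) (h0 _ _) (h0 _ _) (h0 _ _)).trans_eq (by ring)
    refine (sum4_rot4 _).trans_le ?_
    have hKK0 : 0 ≤ Real.sqrt (4 * Real.sqrt (sV) * C3h) := (Real.sqrt_nonneg _)
    have hpw : ∀ x y z t : ι, ((Real.sqrt (4 * Hk y x * Hk s t * Real.sqrt (sV) * C3h) / Real.sqrt (ρ x t * ρ x z) : ℝ)) *
        (ϑ x y * ϑ x z * ϑ x t * ϑ x s * ϑ y z * ϑ y t * ϑ y s * ϑ z t * ϑ z s * ϑ t s) ≤ Real.sqrt (4 * Real.sqrt (sV) * C3h) *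
        (Real.sqrt (Hk s t) * ϑ s t ^ 4 * ((ϑ t x ^ 6 / Real.sqrt (ρ x t)) * ((Real.sqrt (Hk y x) * ϑ x y ^ 4) * (ϑ x z ^ 4 / Real.sqrt (ρ x z)))))
        := fun x y z t =>
      (mul_le_mul_of_nonneg_left (hw x y z t) (div_nonneg (Real.sqrt_nonneg _) (Real.sqrt_nonneg _))).trans_eq
          (by rw [sqrt_split4 (hHk0 y x) (hHk0 s t), Real.sqrt_mul (hρ0 x t).le]; ring)
    refine le_trans
        (Finset.sum_le_sum fun t _ => Finset.sum_le_sum fun x _ => Finset.sum_le_sum fun y _ => Finset.sum_le_sum fun z _ => hpw x y z t) ?_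
    exact sum4_le (K := Real.sqrt (4 * Real.sqrt (sV) * C3h)) (a := fun t => Real.sqrt (Hk s t) * ϑ s t ^ 4)
        (b := fun t x => ϑ t x ^ 6 / Real.sqrt (ρ x t)) (c := fun t x y => Real.sqrt (Hk y x) * ϑ x y ^ 4)
        (d := fun t x y z => ϑ x z ^ 4 / Real.sqrt (ρ x z)) hKK0 (fun t => (mul_nonneg (Real.sqrt_nonneg _) (pow_nonneg (h0 _ _) _)))
        (fun t x => (div_nonneg (pow_nonneg (h0 _ _) _) (Real.sqrt_nonneg _)))
        (fun t x y => (mul_nonneg (Real.sqrt_nonneg _) (pow_nonneg (h0 _ _) _))) hG0 (Real.sqrt_nonneg _) hG0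
        (sum_sqrt_mul_le_letters Finset.univ (a := fun t => Hk s t) (c := fun t => ϑ s t ^ 4) (θ := fun t => ϑ₂ s t) (fun t => hHk0 _ _)
          (fun t => pow_nonneg (h0 _ _) _) (fun t => hϑ₂pos _ _) (hhr s)
          ((Finset.sum_le_sum fun t _ => tmono (h1 s t) (hϑ₂pos s t) (by norm_num : 4 ≤ 4)).trans (hΘ s)))
        (fun t => ((Finset.sum_le_sum fun x _ => rmono (h1 t x) (hρ0 x t) (by norm_num : 6 ≤ 6)).trans (hGsy t)))
        (fun t x =>
          (sum_sqrt_mul_le_letters Finset.univ (a := fun y => Hk y x) (c := fun y => ϑ x y ^ 4) (θ := fun y => ϑ₂ x y) (fun y => hHk0 _ _)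
            (fun y => pow_nonneg (h0 _ _) _) (fun y => hϑ₂pos _ _) (hhc x)
            ((Finset.sum_le_sum fun y _ => tmono (h1 x y) (hϑ₂pos x y) (by norm_num : 4 ≤ 4)).trans (hΘ x))))
        (fun t x y => ((Finset.sum_le_sum fun z _ => rmono (h1 x z) (hρ0 x z) (by norm_num : 4 ≤ 6)).trans (hG x)))
  have tm44 : ∑ x, ∑ y, ∑ z, ∑ t, ((Real.sqrt (2 * K3 t s x * sV * C3k) / Real.sqrt (ρ x y * ρ x z) : ℝ)) *
      (ϑ x y * ϑ x z * ϑ x t * ϑ x s * ϑ y z * ϑ y t * ϑ y s * ϑ z t * ϑ z s * ϑ t s) ≤ Real.sqrt (2 * sV * C3k) *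
      (Real.sqrt (k3mϑ * (Θ8 * Θ8)) * (G * G)) := by
    have hw : ∀ x y z t : ι, ϑ x y * ϑ x z * ϑ x t * ϑ x s * ϑ y z * ϑ y t * ϑ y s * ϑ z t * ϑ z s * ϑ t s ≤ ϑ x y ^ 4 * ϑ x z ^ 4 * ϑ t x ^ 3 * ϑ
        s x ^ 3 * ϑ s t ^ 1 := fun x y z t =>
      (prod10_le le_rfl le_rfl ((hsy x t).le) ((hsy x s).le) ((hm10 y x z))
            (((hm10 y x t).trans (mul_le_mul_of_nonneg_left (hsy x t).le (h0 _ _))))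
            (((hm10 y x s).trans (mul_le_mul_of_nonneg_left (hsy x s).le (h0 _ _))))
            (((hm10 z x t).trans (mul_le_mul_of_nonneg_left (hsy x t).le (h0 _ _))))
            (((hm10 z x s).trans (mul_le_mul_of_nonneg_left (hsy x s).le (h0 _ _)))) ((hsy t s).le) (h0 _ _) (h0 _ _) (h0 _ _) (h0 _ _) (h0 _ _)
            (h0 _ _) (h0 _ _) (h0 _ _) (h0 _ _) (h0 _ _)).trans_eq (by ring)
    refine (sum4_rot4 _).trans_le ?_
    have hKK0 : 0 ≤ Real.sqrt (2 * sV * C3k) := (Real.sqrt_nonneg _)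
    have hpw : ∀ x y z t : ι, ((Real.sqrt (2 * K3 t s x * sV * C3k) / Real.sqrt (ρ x y * ρ x z) : ℝ)) *
        (ϑ x y * ϑ x z * ϑ x t * ϑ x s * ϑ y z * ϑ y t * ϑ y s * ϑ z t * ϑ z s * ϑ t s) ≤ Real.sqrt (2 * sV * C3k) *
        (Real.sqrt (K3 t s x) * (ϑ s t ^ 1 * ϑ s x ^ 3 * ϑ t x ^ 3) * ((ϑ x y ^ 4 / Real.sqrt (ρ x y)) * (ϑ x z ^ 4 / Real.sqrt (ρ x z)))) := fun
        x y z t =>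
      (mul_le_mul_of_nonneg_left (hw x y z t) (div_nonneg (Real.sqrt_nonneg _) (Real.sqrt_nonneg _))).trans_eq
          (by rw [sqrt_split3 (hK30 t s x), Real.sqrt_mul (hρ0 x y).le]; ring)
    refine le_trans
        (Finset.sum_le_sum fun t _ => Finset.sum_le_sum fun x _ => Finset.sum_le_sum fun y _ => Finset.sum_le_sum fun z _ => hpw x y z t) ?_
    exact sum4_le_pair_first (K := Real.sqrt (2 * sV * C3k)) (e := fun t x => Real.sqrt (K3 t s x) * (ϑ s t ^ 1 * ϑ s x ^ 3 * ϑ t x ^ 3))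
        (a := fun t x y => ϑ x y ^ 4 / Real.sqrt (ρ x y)) (b := fun t x y z => ϑ x z ^ 4 / Real.sqrt (ρ x z)) hKK0
        (fun t x =>
          (mul_nonneg (Real.sqrt_nonneg _) (mul_nonneg (mul_nonneg (pow_nonneg (h0 _ _) _) (pow_nonneg (h0 _ _) _)) (pow_nonneg (h0 _ _) _))))
        (fun t x y => (div_nonneg (pow_nonneg (h0 _ _) _) (Real.sqrt_nonneg _))) hG0 hG0
        (sum2_sqrt_mul_le_letters' (a := fun t x => K3 t s x) (c := fun t x => ϑ s t ^ 1 * ϑ s x ^ 3 * ϑ t x ^ 3)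
          (θ := fun t x => ϑ₂ s t * ϑ₂ s x * ϑ₂ t x) (fun t x => hK30 _ _ _)
          (fun t x => mul_nonneg (mul_nonneg (pow_nonneg (h0 _ _) _) (pow_nonneg (h0 _ _) _)) (pow_nonneg (h0 _ _) _))
          (fun t x => mul_pos (mul_pos (hϑ₂pos _ _) (hϑ₂pos _ _)) (hϑ₂pos _ _)) (hk3m s)
          ((Finset.sum_le_sum fun t _ => Finset.sum_le_sum fun x _ => pmono_first (h1 s t) (h1 s x) (h1 t x) (hϑ₂pos s t) (hϑ₂pos s x)
              (hϑ₂pos t x) (hϑsq s t 1 (by norm_num)) (by norm_num : 3 ≤ 4) (by norm_num : 3 ≤ 4)).trans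
            (geom_first (fun x => tnn s x) (fun x => hΘsy x) (hΘ s) hT0)))
        (fun t x => ((Finset.sum_le_sum fun y _ => rmono (h1 x y) (hρ0 x y) (by norm_num : 4 ≤ 6)).trans (hG x)))
        (fun t x y => ((Finset.sum_le_sum fun z _ => rmono (h1 x z) (hρ0 x z) (by norm_num : 4 ≤ 6)).trans (hG x)))
  have tm45 : ∑ x, ∑ y, ∑ z, ∑ t, ((Real.sqrt (4 * Hk z x * Hk s t * Real.sqrt (sV) * C3h) / Real.sqrt (ρ x t * ρ x y) : ℝ)) *
      (ϑ x y * ϑ x z * ϑ x t * ϑ x s * ϑ y z * ϑ y t * ϑ y s * ϑ z t * ϑ z s * ϑ t s) ≤ Real.sqrt (4 * Real.sqrt (sV) * C3h) *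
      (Real.sqrt (hrϑ * Θ8) * (G * (G * Real.sqrt (hcϑ * Θ8)))) := by
    have hw : ∀ x y z t : ι, ϑ x y * ϑ x z * ϑ x t * ϑ x s * ϑ y z * ϑ y t * ϑ y s * ϑ z t * ϑ z s * ϑ t s ≤ ϑ x y ^ 4 * ϑ x z ^ 4 * ϑ t x ^ 6 * ϑ
        s t ^ 4 := fun x y z t =>
      (prod10_le le_rfl le_rfl ((hsy x t).le) (((hm10 x t s).trans (mul_le_mul_of_nonneg_left (hsy t s).le (h0 _ _)))) ((hm10 y x z))
            (((hm10 y x t).trans (mul_le_mul_of_nonneg_left (hsy x t).le (h0 _ _))))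
            (((hm10 y x s).trans (mul_le_mul_of_nonneg_left ((hm10 x t s).trans (mul_le_mul_of_nonneg_left (hsy t s).le (h0 _ _))) (h0 _ _))))
            (((hm10 z x t).trans (mul_le_mul_of_nonneg_left (hsy x t).le (h0 _ _))))
            (((hm10 z x s).trans (mul_le_mul_of_nonneg_left ((hm10 x t s).trans (mul_le_mul_of_nonneg_left (hsy t s).le (h0 _ _))) (h0 _ _))))
            ((hsy t s).le) (h0 _ _) (h0 _ _) (h0 _ _) (h0 _ _) (h0 _ _) (h0 _ _) (h0 _ _) (h0 _ _) (h0 _ _) (h0 _ _)).trans_eq (by ring)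
    refine (sum4_rot4 _).trans_le ?_
    have hKK0 : 0 ≤ Real.sqrt (4 * Real.sqrt (sV) * C3h) := (Real.sqrt_nonneg _)
    have hpw : ∀ x y z t : ι, ((Real.sqrt (4 * Hk z x * Hk s t * Real.sqrt (sV) * C3h) / Real.sqrt (ρ x t * ρ x y) : ℝ)) *
        (ϑ x y * ϑ x z * ϑ x t * ϑ x s * ϑ y z * ϑ y t * ϑ y s * ϑ z t * ϑ z s * ϑ t s) ≤ Real.sqrt (4 * Real.sqrt (sV) * C3h) *
        (Real.sqrt (Hk s t) * ϑ s t ^ 4 * ((ϑ t x ^ 6 / Real.sqrt (ρ x t)) * ((ϑ x y ^ 4 / Real.sqrt (ρ x y)) * (Real.sqrt (Hk z x) * ϑ x z ^ 4))))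
        := fun x y z t =>
      (mul_le_mul_of_nonneg_left (hw x y z t) (div_nonneg (Real.sqrt_nonneg _) (Real.sqrt_nonneg _))).trans_eq
          (by rw [sqrt_split4 (hHk0 z x) (hHk0 s t), Real.sqrt_mul (hρ0 x t).le]; ring)
    refine le_trans
        (Finset.sum_le_sum fun t _ => Finset.sum_le_sum fun x _ => Finset.sum_le_sum fun y _ => Finset.sum_le_sum fun z _ => hpw x y z t) ?_
    exact sum4_le (K := Real.sqrt (4 * Real.sqrt (sV) * C3h)) (a := fun t => Real.sqrt (Hk s t) * ϑ s t ^ 4)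
        (b := fun t x => ϑ t x ^ 6 / Real.sqrt (ρ x t)) (c := fun t x y => ϑ x y ^ 4 / Real.sqrt (ρ x y))
        (d := fun t x y z => Real.sqrt (Hk z x) * ϑ x z ^ 4) hKK0 (fun t => (mul_nonneg (Real.sqrt_nonneg _) (pow_nonneg (h0 _ _) _)))
        (fun t x => (div_nonneg (pow_nonneg (h0 _ _) _) (Real.sqrt_nonneg _)))
        (fun t x y => (div_nonneg (pow_nonneg (h0 _ _) _) (Real.sqrt_nonneg _))) hG0 hG0 (Real.sqrt_nonneg _)
        (sum_sqrt_mul_le_letters Finset.univ (a := fun t => Hk s t) (c := fun t => ϑ s t ^ 4) (θ := fun t => ϑ₂ s t) (fun t => hHk0 _ _)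
          (fun t => pow_nonneg (h0 _ _) _) (fun t => hϑ₂pos _ _) (hhr s)
          ((Finset.sum_le_sum fun t _ => tmono (h1 s t) (hϑ₂pos s t) (by norm_num : 4 ≤ 4)).trans (hΘ s)))
        (fun t => ((Finset.sum_le_sum fun x _ => rmono (h1 t x) (hρ0 x t) (by norm_num : 6 ≤ 6)).trans (hGsy t)))
        (fun t x => ((Finset.sum_le_sum fun y _ => rmono (h1 x y) (hρ0 x y) (by norm_num : 4 ≤ 6)).trans (hG x)))
        (fun t x y =>
          (sum_sqrt_mul_le_letters Finset.univ (a := fun z => Hk z x) (c := fun z => ϑ x z ^ 4) (θ := fun z => ϑ₂ x z) (fun z => hHk0 _ _)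
            (fun z => pow_nonneg (h0 _ _) _) (fun z => hϑ₂pos _ _) (hhc x)
            ((Finset.sum_le_sum fun z _ => tmono (h1 x z) (hϑ₂pos x z) (by norm_num : 4 ≤ 4)).trans (hΘ x))))
  simp (config := { maxSteps := 4000000 }) only [add_mul, Finset.sum_add_distrib]
  linarith [tm39, tm40, tm41, tm42, tm43, tm44, tm45]

/-! ## Toy -/

/-- Toy (a routed load in numbers): carrying four pairs through one edge of weight `2` costs `2⁴ = 16 ≤ 2⁶`. -/
example : (2 : ℝ) ^ 4 ≤ 2 ^ 6 := by norm_num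

end Summit.QuantumFields.BalabanUV.T4Continuum.NE7b.SupWeightedFifthOrderLettersFivePart6

end
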